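import Literature.Computability.Complexity.PolyProducts
import HarnessLib

/-!
# The product tree with halves pairing

Literature / complexity toolkit, continuing `PolyProducts.lean`.  The stack machine builds the
product tree of `2^e` linear factors with the verified passes of the fast multiplier; the
cheapest way to pair the blocks of a level on stacks is NOT adjacent blocks (`pairsOf`) but block
`i` with block `i + h` — move the first half of the level to the first operand batch, the rest
to the second (`StackFFTLevel.moveBlock`).  The product is the same by commutativity:

* `ptStepH N k h L` (one level: `zipWith (negMulRec N k) (take h) (drop h)`, re-padded),
  `ptRunH`, `prodTreeH`; `halfProd` on polynomials with `prod_halfProd`, `length_halfProd`;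
* `ptInv_ptStepH`, `ptInv_ptRunH` and **`prodTreeH_spec`**: for `2^e` values one block of
  exponent `e + 2`, valid and low-half, with polynomial `∏ (x − v_i)`.

## References

* J. von zur Gathen, J. Gerhard, *Modern Computer Algebra*, 3rd ed., CUP 2013, §10.1 (product
  trees). (Folklore material, fully proved here.)
-/

namespace Literature.Computability.Complexity

namespace NegFFT

open _root_.Computability Polynomial

variable (N : ℕ)

/-- One level of the halves-paired product tree at exponent `k` on `2h` blocks: block `i` times
block `i + h`, padded to exponent `k + 1`. [folklore] -/
def ptStepH (k h : ℕ) (L : List (List ℕ)) : List (List ℕ) :=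
  (List.zipWith (negMulRec N k) (L.take h) (L.drop h)).map fun b => b ++ List.replicate (2 ^ k) 0

/-- `s` levels from exponent `k` on `2^s` blocks… on `2^e` blocks: level `j` has `2^{e-j}` blocks. [folklore] -/
def ptRunH : ℕ → ℕ → ℕ → List (List ℕ) → List (List ℕ)
  | _, _, 0, L => L
  | k, e, s + 1, L => ptRunH (k + 1) (e - 1) s (ptStepH N k (2 ^ (e - 1)) L)

/-- The halves-paired product tree of `2^e` values. [folklore] -/
def prodTreeH (e : ℕ) (vs : List ℕ) : List (List ℕ) := ptRunH N 2 e e (vs.map (linBlock (N := N)))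

variable {N}

/-- One level of halves-paired products of polynomials. [folklore] -/
noncomputable def halfProd {R : Type*} [CommRing R] (h : ℕ) (Ps : List R[X]) : List R[X] :=
  List.zipWith (· * ·) (Ps.take h) (Ps.drop h)

/-- The halves-paired products multiply to the product (length `2h`). [folklore] -/
theorem prod_halfProd {R : Type*} [CommRing R] (h : ℕ) (Ps : List R[X]) (hl : Ps.length = 2 * h) : (halfProd h Ps).prod = Ps.prod := by
  have key : ∀ (A B : List R[X]), A.length = B.length → (List.zipWith (· * ·) A B).prod = A.prod * B.prod := by
    intro A
    induction A with
    | nil => intro B hB; cases B with | nil => simp | cons => simp at hB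
    | cons a A ih =>
      intro B hB
      cases B with
      | nil => simp at hB
      | cons b B =>
        rw [List.zipWith_cons_cons, List.prod_cons, ih B (by simpa using hB), List.prod_cons, List.prod_cons]; ring
  rw [halfProd, key _ _ (by rw [List.length_take, List.length_drop, hl]; omega), ← List.prod_append, List.take_append_drop]

/-- Length of `halfProd`. [folklore] -/
theorem length_halfProd {R : Type*} [CommRing R] (h : ℕ) (Ps : List R[X]) (hl : Ps.length = 2 * h) : (halfProd h Ps).length = h := by
  rw [halfProd, List.length_zipWith, List.length_take, List.length_drop, hl]; omega

/-- `Forall₂` passes to `take`/`drop` zips. [folklore] -/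
theorem forall₂_zipWith_halves {α β γ δ : Type*} {R : α → β → Prop} {S : γ → δ → Prop} {f : α → α → γ} {g : β → β → δ}
    (hfg : ∀ a a' b b', R a b → R a' b' → S (f a a') (g b b')) :
    ∀ {l : List α} {l' : List β}, List.Forall₂ R l l' → ∀ {m : List α} {m' : List β}, List.Forall₂ R m m' →
      List.Forall₂ S (List.zipWith f l m) (List.zipWith g l' m')
  | [], [], _, _, _, _ => by simp
  | a :: l, b :: l', h, m, m', hm => by
    rw [List.forall₂_cons] at h
    cases hm with
    | nil => simp
    | cons hab hmm => rw [List.zipWith_cons_cons, List.zipWith_cons_cons, List.forall₂_cons]; exact ⟨hfg _ _ _ _ h.1 hab, forall₂_zipWith_halves hfg h.2 hmm⟩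

/-- **One halves-paired level** keeps the invariant, with the halves products. [folklore] -/
theorem ptInv_ptStepH (hNodd : Odd N) (hN1 : 1 < N) {k h : ℕ} (hk : 1 ≤ k) {L : List (List ℕ)} {Ps : List (ZMod N)[X]}
    (hI : PTInv k L Ps) : PTInv (k + 1) (ptStepH N k h L) (halfProd h Ps) := by
  unfold PTInv ptStepH halfProd
  rw [List.forall₂_map_left_iff]
  have ht : List.Forall₂ (fun b P => BlockOK N (2 ^ k) b ∧ LowHalf k b ∧ listPoly N b = P) (L.take h) (Ps.take h) := List.forall₂_take h hI
  have hd : List.Forall₂ (fun b P => BlockOK N (2 ^ k) b ∧ LowHalf k b ∧ listPoly N b = P) (L.drop h) (Ps.drop h) := List.forall₂_drop h hI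
  refine forall₂_zipWith_halves (S := fun b P => BlockOK N (2 ^ (k + 1)) (b ++ List.replicate (2 ^ k) 0) ∧ LowHalf (k + 1) (b ++ List.replicate (2 ^ k) 0) ∧
    listPoly N (b ++ List.replicate (2 ^ k) 0) = P) (fun a a' P P' ha ha' => ?_) ht hd
  obtain ⟨hb1, hl1, he1⟩ := ha
  obtain ⟨hb2, hl2, he2⟩ := ha'
  obtain ⟨hmul, hblk⟩ := negMulRec_mul hNodd hN1 hk hb1 hb2 hl1 hl2
  refine ⟨⟨?_, fun x hx => ?_⟩, lowHalf_pad hblk.1, ?_⟩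
  · rw [List.length_append, hblk.1, List.length_replicate, pow_succ]; ring
  · rw [List.mem_append] at hx
    rcases hx with hx | hx
    · exact hblk.2 x hx
    · rw [List.eq_of_mem_replicate hx]; omega
  · rw [listPoly_append_replicate_zero, hmul, he1, he2]

/-- Lengths along the invariant. [folklore] -/
theorem PTInv.length_eq' {k : ℕ} {L : List (List ℕ)} {Ps : List (ZMod N)[X]} (hI : PTInv k L Ps) : L.length = Ps.length :=
  List.Forall₂.length_eq hI

/-- The levels keep the invariant (block counts `2^e, 2^{e-1}, …`). [folklore] -/
theorem ptInv_ptRunH (hNodd : Odd N) (hN1 : 1 < N) : ∀ (s : ℕ) {k e : ℕ}, 1 ≤ k → s ≤ e → ∀ {L : List (List ℕ)} {Ps : List (ZMod N)[X]},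
    PTInv k L Ps → Ps.length = 2 ^ e → ∃ Qs, PTInv (k + s) (ptRunH N k e s L) Qs ∧ Qs.length = 2 ^ (e - s) ∧ Qs.prod = Ps.prod
  | 0, k, e, _, _, L, Ps, hI, hl => ⟨Ps, hI, by simpa using hl, rfl⟩
  | s + 1, k, e, hk, hs, L, Ps, hI, hl => by
    have he : e = (e - 1) + 1 := by omega
    have hl2 : Ps.length = 2 * 2 ^ (e - 1) := by
      rw [hl]; conv_lhs => rw [he, pow_succ]
      exact Nat.mul_comm _ _
    have h1 := ptInv_ptStepH hNodd hN1 (h := 2 ^ (e - 1)) hk hI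
    obtain ⟨Qs, hQ, hQl, hQp⟩ := ptInv_ptRunH hNodd hN1 s (k := k + 1) (e := e - 1) (by omega) (by omega) h1 (length_halfProd _ _ hl2)
    refine ⟨Qs, ?_, ?_, ?_⟩
    · rw [ptRunH, show k + (s + 1) = k + 1 + s by omega]; exact hQ
    · rw [hQl]; congr 1; omega
    · rw [hQp, prod_halfProd _ _ hl2]

/-- **The halves-paired product tree**: for `2^e` values, one block of exponent `e + 2`, valid and
low-half, whose polynomial is `∏ (x − v_i)`. [folklore] -/
theorem prodTreeH_spec (hNodd : Odd N) (hN1 : 1 < N) {e : ℕ} {vs : List ℕ} (hvs : vs.length = 2 ^ e) :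
    ∃ b, prodTreeH N e vs = [b] ∧ BlockOK N (2 ^ (e + 2)) b ∧ LowHalf (e + 2) b ∧
      listPoly N b = (vs.map fun v : ℕ => X - C (v : ZMod N)).prod := by
  obtain ⟨Qs, hQ, hQl, hQp⟩ := ptInv_ptRunH hNodd hN1 e (k := 2) (e := e) (by norm_num) le_rfl (ptInv_leaves hN1 vs)
    (by rw [List.length_map, hvs])
  rw [Nat.sub_self, pow_zero] at hQl
  obtain ⟨Q, rfl⟩ := List.length_eq_one_iff.1 hQl
  rw [show (2 : ℕ) + e = e + 2 by omega] at hQ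
  unfold PTInv at hQ
  obtain ⟨b, L', hb, hL', heq⟩ := List.forall₂_cons_right_iff.1 hQ
  rw [List.forall₂_nil_right_iff] at hL'
  subst hL'
  refine ⟨b, heq, hb.1, hb.2.1, ?_⟩
  rw [hb.2.2, ← hQp, List.prod_singleton]

end NegFFT

end Literature.Computability.Complexity
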